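import Literature.AlgebraicGeometry.AbelianSchemes.AbelianSchemeQuotientPoincarePullback
import Literature.AlgebraicGeometry.AbelianSchemes.FibrewisePicZeroDescendsAlongSurjection
import HarnessLib

/-!
# Clause (a) of the descended Poincaré sheaf of a quotient `A/K` (HECKE-LINK H2, file (ii) axiom `h3` by name)

Layer `Literature/AlgebraicGeometry/AbelianSchemes`, namespace
`Literature.AlgebraicGeometry.AbelianSchemes.AbelianSchemeOver`.  THEOREMS ONLY; no definition, no named fact, no
instance, no notation, no `sorry`.

Setting of ★ `AbelianSchemeQuotientPoincarePullback` ((ii) part 1 of the two-step descent, [MumfordAV1970] §15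
Thm. 1: «the dual of `A/C` is `Â/C^⊥`»): `B := A/K` (★ `quotientBy`), `π : B → A` (★ `mulNDesc`), a dual pair
`D = (Â, 𝒫)` of `A`, the rigidified fibrewise-`Pic⁰` family `𝒩₁ = (π × 1)^*𝒫` on `B_{Â}` (★ `poincarePullbackBundle`,
module ★ `poincarePullback`), a finite subgroup `K′ ≤ Â(S)` with the file-(i) hypotheses for `(Â, K′)`, the quotient
`B̂ := Â/K′` with `ψ̂ : Â → B̂` (★ `quotientMk`), and ANY module `PB` on `B ×_S B̂` together with an isomorphism
`(1_B × ψ̂)^* PB ≅ 𝒩₁` (the defining property of the descended Poincaré sheaf, however it is constructed).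

* **`forall_isHomogeneous_fibreSlice_of_descended`** — `PB` satisfies clause (a) of ★ `DualPair` over `B̂`: for every
  geometric point `b` of `B̂`, the slice `PB|_{B_s × {b}}` is translation invariant.  This is EXACTLY the hypothesis
  `h3` of the (ii) assembly `dualPairOfQuotient`, discharged from `ePB` alone by ★
  `RigidifiedLineBundle.forall_isHomogeneous_fibreSlice_of_rigidified_of_surjective` (geometric points of `B̂` lift
  along the finite surjective `ψ̂` with the same algebraically closed field; `𝒩₁` is fibrewise in `Pic⁰` by ★
  `poincarePullbackBundle_fibrewisePicZero`).

HC_CM is proved only modulo the 7 printed citations until rung 0 closes; nothing here is about HC.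

## References
* [MumfordAV1970] D. Mumford, *Abelian Varieties* (1970), §8 ((iv) ⇔ (i)); §15 Thm. 1 (p. 143).
* [MilneAV2008] J. S. Milne, *Abelian Varieties* (2008), I §8 (pp. 36–37).
-/

noncomputable section

universe u

open CategoryTheory CategoryTheory.Limits AlgebraicGeometry MonoidalCategory CartesianMonoidalCategory
open scoped MonObj

namespace Literature.AlgebraicGeometry.AbelianSchemes

namespace AbelianSchemeOver

open Literature.AlgebraicGeometry.RelativeSpec Literature.AlgebraicGeometry.AbelianVarieties
  Literature.AlgebraicGeometry.Motives

variable {S : Scheme.{u}} (A : AbelianSchemeOver S)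
  {Y : Scheme.{u}} (u : S ⟶ Y) (K : Subgroup A.Sections) [IsCommMonObj A.X] {n : ℕ}
  (hK : ∀ σ : K, (σ : A.Sections) ^ n = 1)
  [Finite K] [Y.IsSeparated] [IsSeparated (A.X.hom ≫ u)] [S.IsSeparated]
  (hcov : ∀ x : A.left, ∃ O : (A.translationActionOver u K).StableAffineOpens, x ∈ O.1)
  [LocallyOfFiniteType (A.X.hom ≫ u)] [IsLocallyNoetherian Y]
  (hG : ∃ _ : GrpObj (A.quotientOver u K), IsMonHom (A.quotientMk u K hcov))
  (hsm : Smooth (A.quotientOver u K).hom) (hgc : GeometricallyConnected (A.quotientOver u K).hom)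
  (D : A.DualPair)

variable [IsAffine Y]
  (hfree : ∀ (Ω : Type u) [Field Ω] [IsAlgClosed Ω] (x : Spec (.of Ω) ⟶ A.left) (σ : K), σ ≠ 1 →
    x ≫ (A.translation (σ : A.Sections)).left ≠ x)

section DualSide

variable (K' : Subgroup D.hat.Sections) [Finite K'] [IsSeparated (D.hat.X.hom ≫ u)]
  (hcov' : ∀ x : D.hat.left, ∃ O : (D.hat.translationActionOver u K').StableAffineOpens, x ∈ O.1)
  [LocallyOfFiniteType (D.hat.X.hom ≫ u)]
  (hG' : ∃ _ : GrpObj (D.hat.quotientOver u K'), IsMonHom (D.hat.quotientMk u K' hcov'))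
  (hsm' : Smooth (D.hat.quotientOver u K').hom) (hgc' : GeometricallyConnected (D.hat.quotientOver u K').hom)

/-- **Clause (a) of the descended Poincaré sheaf (axiom `h3` of the (ii) assembly, by name).**  For ANY module `PB`
on `(A/K) ×_S (Â/K′)` with `(1 × ψ̂)^* PB ≅ 𝒩₁ = (π × 1)^*𝒫`: at every geometric point `b` of `Â/K′` the slice
`PB|_{(A/K)_s × {b}}` is translation invariant ([MumfordAV1970, §8 (iv) ⇔ (i)]) — the text of the field
`fibrewisePicZero` of ★ `DualPair` at `(A/K, Â/K′, PB)`.  Proof: ★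
`RigidifiedLineBundle.forall_isHomogeneous_fibreSlice_of_rigidified_of_surjective` with `ℒ := 𝒩₁`
(★ `poincarePullbackBundle`, fibrewise in `Pic⁰` by ★ `poincarePullbackBundle_fibrewisePicZero`) and `q := ψ̂`
(finite surjective). [cite: MumfordAV1970, §8 ((iv) ⇔ (i)); §15 Thm. 1 (p. 143)] [cite: MilneAV2008, I §8 (pp. 36–37)] -/
theorem forall_isHomogeneous_fibreSlice_of_descended
    (PB : (((A.quotientBy u K hcov hG hsm hgc).X ⊗ (D.hat.quotientBy u K' hcov' hG' hsm' hgc').X).left).Modules)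
    (ePB : Nonempty ((Scheme.Modules.pullback
      ((A.quotientBy u K hcov hG hsm hgc).X ◁ D.hat.quotientMk u K' hcov').left).obj PB ≅
        A.poincarePullback u K hK hcov hG hsm hgc D hfree))
    (Ω : Type u) [Field Ω] [IsAlgClosed Ω] (b : Spec (.of Ω) ⟶ (D.hat.quotientBy u K' hcov' hG' hsm' hgc').X.left) :
    IsHomogeneous ((A.quotientBy u K hcov hG hsm hgc).fibre
        (b ≫ (D.hat.quotientBy u K' hcov' hG' hsm' hgc').X.hom)).toAbelianVariety
      ((Scheme.Modules.pullback ((A.quotientBy u K hcov hG hsm hgc).fibreSlice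
        (D.hat.quotientBy u K' hcov' hG' hsm' hgc') b)).obj PB) :=
  -- ★ `quotientMk_left_surjective` / `isFinite_quotientMk_left`, keyed on the `quotientBy`-typed spelling of `ψ̂`
  -- (`(quotientBy …).X = quotientOver …` is `rfl` but not reducible, so instance search needs this spelling)
  haveI : Surjective (show D.hat.X ⟶ (D.hat.quotientBy u K' hcov' hG' hsm' hgc').X from
      D.hat.quotientMk u K' hcov').left := ⟨D.hat.quotientMk_left_surjective u K' hcov'⟩
  haveI : IsFinite (show D.hat.X ⟶ (D.hat.quotientBy u K' hcov' hG' hsm' hgc').X from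
      D.hat.quotientMk u K' hcov').left := D.hat.isFinite_quotientMk_left u K' hcov'
  RigidifiedLineBundle.forall_isHomogeneous_fibreSlice_of_rigidified_of_surjective D.hat
    (A.poincarePullbackBundle u K hK hcov hG hsm hgc D hfree) (D.hat.quotientBy u K' hcov' hG' hsm' hgc')
    (D.hat.quotientMk u K' hcov') PB (A.poincarePullbackBundle_fibrewisePicZero u K hK hcov hG hsm hgc D hfree) ePB Ω b

end DualSide

end AbelianSchemeOver

end Literature.AlgebraicGeometry.AbelianSchemes

end
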